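import Summits.CriticalPhenomena.Ising3DConformalLimit.Theses.ReflectionTwin
import Summits.CriticalPhenomena.Ising3DConformalLimit.Theorems.HyperoctahedralRPExistsScaleCovariantLimitDecimationTwoCouplingGKS
import HarnessLib

/-!
# Crux `TwinThreshold` (stmt-CriticalPhenomena-16906), line `seam_renewal` — stub `stub_seamMonotone` ((M) Griffiths monotonicity in the seam coupling)

GKS II: for 0 <= J <= J' every coupling of TW(J) is nonnegative and entrywise below that of TW(J'); the box monomial with junk 0
is a spin product or identically 0; `ciSup_mono` over boxes.

Registered stub of the checked skeleton `Cruxes/TwinThreshold/Lines/seam_renewal.lean`; proved EXACTLY as registered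
(`--supports stmt-CriticalPhenomena-16906`). Helper lemmas are private/local to this file.
-/

noncomputable section

namespace Summit.CriticalPhenomena.Ising3DConformalLimit.Cruxes.TwinThreshold.SeamRenewal

open scoped BigOperators Classical
open Filter Topology Finset
open Literature.Probability.LatticeModels
open Summit.CriticalPhenomena.Ising3DConformalLimit.Cruxes.ExistsScaleCovariantLimit.DecimationHomotopyRate

/-! ## Private helpers: the seam coupling comparison, box monomials with junk `0`, GKS per box -/

/-- Entrywise comparison of the twin couplings: for `0 ≤ J ≤ J'` every coupling of `TW(J)` is, in absolute value, at most
the corresponding coupling of `TW(J')` (bulk bonds `β_c/2`, seam bonds `β_c J/2 ≤ β_c J'/2`, non-bonds `0`). [folklore] -/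
private theorem abs_seamCoupling_le {P Q : Prop} [Decidable P] [Decidable Q] {J J' : ℝ} (hJ : 0 ≤ J) (hJJ' : J ≤ J') :
    |(if P then (criticalBeta 3 / 2) * (if Q then J else 1) else 0 : ℝ)| ≤
      (if P then (criticalBeta 3 / 2) * (if Q then J' else 1) else 0 : ℝ) := by
  have hβ : 0 ≤ criticalBeta 3 / 2 := div_nonneg (criticalBeta_nonneg 3) zero_le_two
  split_ifs
  · rw [abs_of_nonneg (mul_nonneg hβ hJ)]
    exact mul_le_mul_of_nonneg_left hJJ' hβ
  · rw [abs_of_nonneg (mul_nonneg hβ zero_le_one)]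
  · rw [abs_zero]

/-- The box monomial with junk factor `0`, `∏ᵢ (σ_{zᵢ} if zᵢ ∈ Λ_L else 0)`, has absolute value at most `1`. [folklore] -/
private theorem abs_boxMonomial₀_le_one (L : ℕ) {n : ℕ} (z : Fin n → Site 3) (s : SpinConfig ↥(box 3 L)) :
    |(∏ i, if h : z i ∈ box 3 L then spinAt (⟨z i, h⟩ : ↥(box 3 L)) s else 0 : ℝ)| ≤ 1 := by
  rw [Finset.abs_prod]
  refine Finset.prod_le_one (fun _ _ => abs_nonneg _) fun i _ => ?_
  split_ifs
  · rw [abs_spinAt]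
  · rw [abs_zero]; exact zero_le_one

/-- **Griffiths' comparison for the box monomial with junk `0`**: if `|c| ≤ c'` entrywise then
`⟨∏ᵢ σ_{zᵢ}⟩_c ≤ ⟨∏ᵢ σ_{zᵢ}⟩_{c'}` — when all sites lie in the box the monomial is a spin product `σ_A` (GKS II /
Griffiths' comparison, `gibbsAvg_spinProduct_mono`); otherwise it is identically `0`. [cite: FriedliVelenik2017, Exercise 3.31, p. 142] -/
private theorem gibbsAvg_boxMonomial₀_mono (L : ℕ) {c c' : ↥(box 3 L) → ↥(box 3 L) → ℝ} (hcc' : ∀ a b, |c a b| ≤ c' a b)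
    {n : ℕ} (z : Fin n → Site 3) :
    PairIsing.gibbsAvg c (fun s => ∏ i, if h : z i ∈ box 3 L then spinAt (⟨z i, h⟩ : ↥(box 3 L)) s else 0) ≤
      PairIsing.gibbsAvg c' (fun s => ∏ i, if h : z i ∈ box 3 L then spinAt (⟨z i, h⟩ : ↥(box 3 L)) s else 0) := by
  by_cases hz : ∀ i, z i ∈ box 3 L
  · -- all sites in the box: the monomial is a spin product
    obtain ⟨A, hA⟩ := TwoCouplingGKS.exists_prod_spinAt_eq_spinProduct (V := ↥(box 3 L)) (Finset.univ : Finset (Fin n))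
      (fun i => (⟨z i, hz i⟩ : ↥(box 3 L)))
    have hf : (fun s : SpinConfig ↥(box 3 L) => ∏ i, if h : z i ∈ box 3 L then spinAt (⟨z i, h⟩ : ↥(box 3 L)) s else 0) =
        spinProduct A := by
      rw [← hA]
      funext s
      exact Finset.prod_congr rfl fun i _ => dif_pos (hz i)
    rw [hf]
    exact TwoCouplingGKS.gibbsAvg_spinProduct_mono hcc' A
  · -- some site outside the box: the monomial vanishes identically
    obtain ⟨i, hi⟩ := not_forall.mp hz
    have hf : (fun s : SpinConfig ↥(box 3 L) => ∏ i, if h : z i ∈ box 3 L then spinAt (⟨z i, h⟩ : ↥(box 3 L)) s else 0) =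
        fun _ => 0 := by
      funext s
      exact Finset.prod_eq_zero (Finset.mem_univ i) (dif_neg hi)
    rw [hf, PairIsing.gibbsAvg_const, PairIsing.gibbsAvg_const]

/-- **(M) Griffiths monotonicity in the seam coupling.** For `0 ≤ J ≤ J'` and every site `c`, the box-supremum two-point
function `sup_L ⟨σ₀σ_c⟩_{TW(J), Λ_L}` of the (111) reflection twin at bulk `β_c(3)` is nondecreasing in the seam coupling `J`.
Proof: every coupling of `TW(J)` is nonnegative (`β_c(3) ≥ 0`) and entrywise below that of `TW(J')`, the observable
`∏ᵢ (σ_{zᵢ} if zᵢ ∈ Λ_L else 0)` is a spin product `σ_A` or identically `0`, so Griffiths' comparison inequality (GKS II)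
orders the box averages for every `L`; the suprema over `L` (bounded by `1`) follow by `ciSup_mono`.
[cite: FriedliVelenik2017, Exercise 3.31, p. 142] -/
theorem stub_seamMonotone : open Literature.Probability.LatticeModels in ((fun (twinLat : ℝ → (k : ℕ) → (Fin k → Site 3) → ℝ) => ∀ J J' : ℝ, 0 ≤ J → J ≤ J' → ∀ c : Site 3, twinLat J 2 ![0, c] ≤ twinLat J' 2 ![0, c]) (fun (J : ℝ) (k : ℕ) (z : Fin k → Site 3) => ⨆ L : ℕ, PairIsing.gibbsAvg (fun a b : ↥(box 3 L) => if (((∑ i, |a.1 i - b.1 i| = 1) ∧ ¬ ((a.1 0 + a.1 1 + a.1 2 = 0 ∧ b.1 0 + b.1 1 + b.1 2 = 1) ∨ (a.1 0 + a.1 1 + a.1 2 = 1 ∧ b.1 0 + b.1 1 + b.1 2 = 0))) ∨ (((a.1 0 + a.1 1 + a.1 2 = 0 ∧ b.1 0 + b.1 1 + b.1 2 = 1) ∨ (a.1 0 + a.1 1 + a.1 2 = 1 ∧ b.1 0 + b.1 1 + b.1 2 = 0)) ∧ ∃ i : Fin 3, a.1 + b.1 = Pi.single i 1)) then (criticalBeta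 3 / 2) * (if a.1 0 + a.1 1 + a.1 2 = 0 ∨ b.1 0 + b.1 1 + b.1 2 = 0 then J else 1) else 0) (fun s => ∏ i, if h : z i ∈ box 3 L then spinAt (⟨z i, h⟩ : ↥(box 3 L)) s else 0))) := by
  intro J J' hJ hJJ' c
  refine ciSup_mono ⟨1, ?_⟩ fun L => ?_
  · rintro _ ⟨L, rfl⟩
    exact (le_abs_self _).trans (TwoCouplingGKS.abs_gibbsAvg_le_one _ fun s => abs_boxMonomial₀_le_one L _ s)
  · exact gibbsAvg_boxMonomial₀_mono L (fun a b => abs_seamCoupling_le hJ hJJ') _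

end Summit.CriticalPhenomena.Ising3DConformalLimit.Cruxes.TwinThreshold.SeamRenewal

end
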